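import Summits.AtomisticToContinuum.HydrodynamicLimit.Theorems.JParityClosureParityInBandSmoothTest
import Summits.AtomisticToContinuum.HydrodynamicLimit.Theorems.InformationPercolationEngineKineticClosureConservation
import Summits.AtomisticToContinuum.HydrodynamicLimit.Theorems.ImplosionDichotomyHsEosLowDensity

/-!
# Route JParityClosure — `Assembly` (stmt-AtomisticToContinuum-17595): the fixed-time ENERGY conjunct is one-sided

Helper toward the assembly item `JParityClosure.Assembly` (≡ the closure crux `ParityBandClosure`,
stmt-AtomisticToContinuum-17608, by `jParityClosure_assembly_iff_parityBandClosure`). The conclusion of the item is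
the packing-guarded conjunct `_root_.HydrodynamicLimit`, i.e. `TendstoHydroFieldsAt … t` at EVERY `t ∈ [0,T)`; its
third component (the empirical ENERGY field against every continuous `χ`) is the one the route's inputs do not reach
at a fixed instant (gap G1 of the item's notes: the typed cruxes control time- and collision-integrated statistics,
the density sup and quadratic velocity tails, none of which sees an instantaneous spatial redistribution of kinetic
energy carried by fast particles over a vanishing time window). This file records the elementary but useful fact that
the energy component is ONE-SIDED:

* `tendsto_energyField_of_lower_of_total` (abstract laws `P N`, flows `Φ N`, continuous limit density `E`): if for
  every NONNEGATIVE continuous `χ` the LOWER deviations `{⟨E_N(t), χ⟩ < ∫ χE − δ}` have vanishing probability and the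
  UPPER deviation of the TOTAL `{∫ E + δ < ⟨E_N(t), 1⟩}` has vanishing probability, then the two-sided energy
  component of `TendstoHydroFieldsAt … t` holds for every continuous `χ` (write `χ = (χ + C) − C` and
  `χ = C − (C − χ)` with `C > sup |χ|`).
* `energyConjunct_of_lower` (the guarded frame of the Statement): along a classical hard-sphere-Euler solution in a
  packing band `ρσ³ < η₀` (the `η₀` of the smooth-pressure lemma fed with the PROVED support `hsEosLowDensity_proof`),
  for every flow family tied to the data at `t = 0`, the upper total deviation is automatic at every `t ∈ [0,T)`
  (kinetic energy is conserved on the good set, the Euler total energy is conserved: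
  `KineticClosureConservation.tendsto_energyField_const`), so the energy component at time `t` follows from the lower
  deviations for nonnegative `χ` ALONE.

Consequence for whoever closes crux 7: at a fixed instant only LOWER semicontinuity of the local kinetic energy is
needed (e.g. Fatou along any identification of the one-particle law at time `t`; no uniform integrability of `|v|²`
enters the energy component once the law at `t` is known), the upper half being paid for by the exact conservation
laws. Pure measure-theoretic bookkeeping over the tree's definitions; no new objects.
-/

noncomputable section

namespace Summit.AtomisticToContinuum.HydrodynamicLimit.Theorems

open Set MeasureTheory Filter Topology
open scoped ENNReal
open Literature.MathematicalPhysics.KineticTheory Literature.Analysis.FluidPDE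
open Literature.Analysis.FunctionSpaces

/-- Linearity of the empirical energy field in the test function: adding a constant `c` to `χ` adds `c` times the
energy field of `1`. [folklore] -/
theorem empiricalEnergyField_add_const {N : ℕ} (z : Config N (Fin 3) T3) (χ : T3 → ℝ) (c : ℝ) :
    empiricalEnergyField z (fun x => χ x + c) =
      empiricalEnergyField z χ + c * empiricalEnergyField z (fun _ => 1) := by
  simp only [empiricalEnergyField, integral_empiricalMeasure, Finset.mul_sum, ← Finset.sum_add_distrib]
  refine Finset.sum_congr rfl fun i _ => ?_
  ring

/-- Linearity of the empirical energy field in the test function: the field of `c − χ` is `c` times the field of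
`1` minus the field of `χ`. [folklore] -/
theorem empiricalEnergyField_const_sub {N : ℕ} (z : Config N (Fin 3) T3) (χ : T3 → ℝ) (c : ℝ) :
    empiricalEnergyField z (fun x => c - χ x) =
      c * empiricalEnergyField z (fun _ => 1) - empiricalEnergyField z χ := by
  simp only [empiricalEnergyField, integral_empiricalMeasure, Finset.mul_sum, ← Finset.sum_sub_distrib]
  refine Finset.sum_congr rfl fun i _ => ?_
  ring

/-- **The fixed-time energy component is one-sided.** Let `P N` be laws on `(N+1)`-particle phase space, `Φ N`
hard-sphere flows, `E : 𝕋³ → ℝ` a continuous limit energy density and `t` a time. Assume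
(i) LOWER deviations vanish for nonnegative test functions: for every continuous `χ ≥ 0` and `δ > 0`,
`P N {⟨E_N(t), χ⟩ < ∫ χE − δ} → 0`; (ii) the UPPER deviation of the total vanishes: for every `δ > 0`,
`P N {∫ E + δ < ⟨E_N(t), 1⟩} → 0`. Then for every continuous `χ` and `δ > 0`,
`P N {δ < |⟨E_N(t), χ⟩ − ∫ χE|} → 0` — the energy component of `TendstoHydroFieldsAt … t`. Proof: with
`C > sup |χ|`, the lower deviation of `χ` is controlled by the lower deviation of `χ + C ≥ 0` and the upper total
deviation, the upper deviation of `χ` by the lower deviation of `C − χ ≥ 0` and the upper total deviation.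
[folklore] -/
theorem tendsto_energyField_of_lower_of_total {ε : ℕ → ℝ}
    (P : (N : ℕ) → Measure (Config (N + 1) (Fin 3) T3))
    (Φ : (N : ℕ) → HardSphereFlow (Torus.geometry (Fin 3)) (ε N) (N + 1))
    (E : T3 → ℝ) (hE : Continuous E) (t : ℝ)
    (hlow : ∀ χ : T3 → ℝ, Continuous χ → (∀ x, 0 ≤ χ x) → ∀ δ : ℝ, 0 < δ →
      Tendsto (fun N => P N {z | empiricalEnergyField ((Φ N).flow t z) χ < (∫ x, χ x * E x) - δ})
        atTop (𝓝 0))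
    (htot : ∀ δ : ℝ, 0 < δ →
      Tendsto (fun N => P N {z | (∫ x, E x) + δ < empiricalEnergyField ((Φ N).flow t z) (fun _ => 1)})
        atTop (𝓝 0)) :
    ∀ χ : T3 → ℝ, Continuous χ → ∀ δ : ℝ, 0 < δ →
      Tendsto (fun N => P N {z | δ < |empiricalEnergyField ((Φ N).flow t z) χ - ∫ x, χ x * E x|})
        atTop (𝓝 0) := by
  intro χ hχ δ hδ
  obtain ⟨B, hB0, hB⟩ := exists_abs_le_of_continuous_T3 hχ
  set C : ℝ := B + 1 with hC
  have hCpos : 0 < C := by rw [hC]; linarith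
  have hχC : ∀ x, |χ x| ≤ C := fun x => (hB x).trans (by rw [hC]; linarith)
  -- integrability of the continuous limit integrands on the compact torus
  have hint : ∀ {f : T3 → ℝ}, Continuous f → Integrable f (volume : Measure T3) := fun hf =>
    hf.integrable_of_hasCompactSupport (HasCompactSupport.of_compactSpace _)
  -- limit-side linearity
  have iχE : Integrable (fun x => χ x * E x) (volume : Measure T3) := hint (hχ.mul hE)
  have iCE : Integrable (fun x => C * E x) (volume : Measure T3) := hint (continuous_const.mul hE)
  have hI1 : (∫ x, (χ x + C) * E x) = (∫ x, χ x * E x) + C * ∫ x, E x := by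
    have e : (fun x => (χ x + C) * E x) = fun x => χ x * E x + C * E x := by
      funext x; ring
    rw [e, integral_add (f := fun x => χ x * E x) (g := fun x => C * E x) iχE iCE, integral_const_mul]
  have hI2 : (∫ x, (C - χ x) * E x) = C * (∫ x, E x) - ∫ x, χ x * E x := by
    have e : (fun x => (C - χ x) * E x) = fun x => C * E x - χ x * E x := by
      funext x; ring
    rw [e, integral_sub (f := fun x => C * E x) (g := fun x => χ x * E x) iCE iχE, integral_const_mul]
  -- the three vanishing sequences
  have h1 : Tendsto (fun N => P N {z | empiricalEnergyField ((Φ N).flow t z) (fun x => χ x + C) <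
      (∫ x, (χ x + C) * E x) - δ / 2}) atTop (𝓝 0) :=
    hlow (fun x => χ x + C) (hχ.add continuous_const)
      (fun x => by linarith [neg_abs_le (χ x), hχC x]) (δ / 2) (half_pos hδ)
  have h2 : Tendsto (fun N => P N {z | empiricalEnergyField ((Φ N).flow t z) (fun x => C - χ x) <
      (∫ x, (C - χ x) * E x) - δ / 2}) atTop (𝓝 0) :=
    hlow (fun x => C - χ x) (continuous_const.sub hχ)
      (fun x => by linarith [le_abs_self (χ x), hχC x]) (δ / 2) (half_pos hδ)
  have h3 : Tendsto (fun N => P N {z | (∫ x, E x) + δ / (2 * C) <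
      empiricalEnergyField ((Φ N).flow t z) (fun _ => 1)}) atTop (𝓝 0) :=
    htot (δ / (2 * C)) (by positivity)
  -- the inclusion of events
  have hsub : ∀ N, {z | δ < |empiricalEnergyField ((Φ N).flow t z) χ - ∫ x, χ x * E x|} ⊆
      ({z | empiricalEnergyField ((Φ N).flow t z) (fun x => χ x + C) < (∫ x, (χ x + C) * E x) - δ / 2} ∪
        {z | empiricalEnergyField ((Φ N).flow t z) (fun x => C - χ x) < (∫ x, (C - χ x) * E x) - δ / 2}) ∪
      {z | (∫ x, E x) + δ / (2 * C) < empiricalEnergyField ((Φ N).flow t z) (fun _ => 1)} := by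
    intro N z hz
    simp only [mem_setOf_eq, mem_union] at hz ⊢
    by_contra hcon
    simp only [not_or, not_lt] at hcon
    obtain ⟨⟨hc1, hc2⟩, hc3⟩ := hcon
    set z' := (Φ N).flow t z with hz'
    rw [empiricalEnergyField_add_const z' χ C, hI1] at hc1
    rw [empiricalEnergyField_const_sub z' χ C, hI2] at hc2
    have hC3 : C * empiricalEnergyField z' (fun _ => 1) ≤ C * (∫ x, E x) + δ / 2 := by
      have hm := mul_le_mul_of_nonneg_left hc3 hCpos.le
      have e : C * ((∫ x, E x) + δ / (2 * C)) = C * (∫ x, E x) + δ / 2 := by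
        field_simp
      linarith [hm, e.le, e.ge]
    have hlo : -δ ≤ empiricalEnergyField z' χ - ∫ x, χ x * E x := by linarith
    have hup : empiricalEnergyField z' χ - ∫ x, χ x * E x ≤ δ := by linarith
    have habs : |empiricalEnergyField z' χ - ∫ x, χ x * E x| ≤ δ := abs_le.2 ⟨hlo, hup⟩
    linarith
  have hle : ∀ N, P N {z | δ < |empiricalEnergyField ((Φ N).flow t z) χ - ∫ x, χ x * E x|} ≤
      P N {z | empiricalEnergyField ((Φ N).flow t z) (fun x => χ x + C) < (∫ x, (χ x + C) * E x) - δ / 2} +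
        P N {z | empiricalEnergyField ((Φ N).flow t z) (fun x => C - χ x) < (∫ x, (C - χ x) * E x) - δ / 2} +
      P N {z | (∫ x, E x) + δ / (2 * C) < empiricalEnergyField ((Φ N).flow t z) (fun _ => 1)} := fun N =>
    (measure_mono (hsub N)).trans ((measure_union_le _ _).trans (add_le_add (measure_union_le _ _) le_rfl))
  have hsum : Tendsto (fun N =>
      P N {z | empiricalEnergyField ((Φ N).flow t z) (fun x => χ x + C) < (∫ x, (χ x + C) * E x) - δ / 2} +
        P N {z | empiricalEnergyField ((Φ N).flow t z) (fun x => C - χ x) < (∫ x, (C - χ x) * E x) - δ / 2} +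
      P N {z | (∫ x, E x) + δ / (2 * C) < empiricalEnergyField ((Φ N).flow t z) (fun _ => 1)}) atTop (𝓝 0) := by
    simpa using (h1.add h2).add h3
  exact tendsto_of_tendsto_of_tendsto_of_le_of_le tendsto_const_nhds hsum (fun N => zero_le) hle

/-- **The upper total deviation from the two-sided total deviation**: `{∫ E + δ < ⟨E_N(t), 1⟩}` is contained in
`{δ < |⟨E_N(t), 1⟩ − ∫ 1·E|}`, so the `χ ≡ 1` energy component of `TendstoHydroFieldsAt … t` supplies hypothesis
(ii) of `tendsto_energyField_of_lower_of_total`. [folklore] -/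
theorem tendsto_totalUpper_of_tendsto_abs {ε : ℕ → ℝ}
    (P : (N : ℕ) → Measure (Config (N + 1) (Fin 3) T3))
    (Φ : (N : ℕ) → HardSphereFlow (Torus.geometry (Fin 3)) (ε N) (N + 1))
    (E : T3 → ℝ) (t : ℝ)
    (h : ∀ δ : ℝ, 0 < δ → Tendsto (fun N => P N {z | δ < |empiricalEnergyField ((Φ N).flow t z) (fun _ => 1) -
      ∫ x, (1 : ℝ) * E x|}) atTop (𝓝 0)) :
    ∀ δ : ℝ, 0 < δ →
      Tendsto (fun N => P N {z | (∫ x, E x) + δ < empiricalEnergyField ((Φ N).flow t z) (fun _ => 1)})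
        atTop (𝓝 0) := by
  intro δ hδ
  refine tendsto_of_tendsto_of_tendsto_of_le_of_le tendsto_const_nhds (h δ hδ) (fun N => zero_le)
    fun N => measure_mono fun z hz => ?_
  simp only [mem_setOf_eq, one_mul] at hz ⊢
  have : δ < empiricalEnergyField ((Φ N).flow t z) (fun _ => 1) - ∫ x, E x := by linarith
  exact this.trans_le (le_abs_self _)

/-- **In the guarded frame of the Statement the energy component at a fixed time follows from LOWER bounds alone.**
There is a packing threshold `η₀ > 0` (the one of the smooth-pressure lemma fed with the PROVED support
`hsEosLowDensity_proof`) such that: for `0 < σ`, every classical hard-sphere-Euler solution `(ρ, u, θ)` on `[0,T)`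
with `ρσ³ < η₀` throughout, every flow family `Φ` and profiles whose local Gibbs laws are tied to the data at `t = 0`
(`TendstoHydroFieldsAt … 0`), and every `t ∈ [0,T)`: IF for every nonnegative continuous `χ` and `δ > 0` the lower
deviation events `{⟨E_N(t), χ⟩ < ∫ χE(t) − δ}` have vanishing local-Gibbs probability, THEN the full (two-sided,
all continuous `χ`) energy component of `TendstoHydroFieldsAt … t` holds. The upper half is paid for by conservation
of the kinetic energy on the good set and of the Euler total energy
(`KineticClosureConservation.tendsto_energyField_const`). [folklore] -/
theorem energyConjunct_of_lower :
    ∃ η₀ : ℝ, 0 < η₀ ∧ ∀ (σ T : ℝ) (a₀ θ₀ : T3 → ℝ) (u₀ : T3 → V3) (ρ θ : ℝ → T3 → ℝ) (u : ℝ → T3 → V3),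
      0 < σ → IsHardSphereEulerSolution σ T ρ u θ → (∀ t ∈ Ico 0 T, ∀ x, ρ t x * σ ^ 3 < η₀) →
      ∀ Φ : (N : ℕ) → HardSphereFlow (Torus.geometry (Fin 3)) (hsDiameter σ N) (N + 1),
        TendstoHydroFieldsAt (fun N => localGibbsLaw σ a₀ u₀ θ₀ N (Φ N)) Φ ρ u θ 0 →
        ∀ t ∈ Ico 0 T,
          (∀ χ : T3 → ℝ, Continuous χ → (∀ x, 0 ≤ χ x) → ∀ δ : ℝ, 0 < δ →
            Tendsto (fun N => localGibbsLaw σ a₀ u₀ θ₀ N (Φ N)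
              {z | empiricalEnergyField ((Φ N).flow t z) χ <
                (∫ x, χ x * totalEnergyDensity (ρ t x) (u t x) (θ t x)) - δ}) atTop (𝓝 0)) →
          ∀ χ : T3 → ℝ, Continuous χ → ∀ δ : ℝ, 0 < δ →
            Tendsto (fun N => localGibbsLaw σ a₀ u₀ θ₀ N (Φ N)
              {z | δ < |empiricalEnergyField ((Φ N).flow t z) χ -
                ∫ x, χ x * totalEnergyDensity (ρ t x) (u t x) (θ t x)|}) atTop (𝓝 0) := by
  obtain ⟨η₀, hη₀, hP⟩ := PolynomialCompressionSmoothPressure.isSmoothSpaceTimeOn_pressure hsEosLowDensity_proof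
  refine ⟨η₀, hη₀, fun σ T a₀ θ₀ u₀ ρ θ u hσ hE hpack Φ h0 t ht hlow => ?_⟩
  have hp := hP σ T ρ θ u hσ hE hpack
  have hρc : Continuous (ρ t) := (hE.smooth_density.isSmooth_slice ht).continuous
  have huc : Continuous (u t) := (hE.smooth_velocity.isSmooth_slice ht).continuous
  have hθc : Continuous (θ t) := (hE.smooth_temperature.isSmooth_slice ht).continuous
  have hEc : Continuous fun x => totalEnergyDensity (ρ t x) (u t x) (θ t x) := by
    unfold totalEnergyDensity
    exact hρc.mul (((continuous_norm.comp huc).pow 2).div_const _ |>.add (continuous_const.mul hθc))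
  refine tendsto_energyField_of_lower_of_total (fun N => localGibbsLaw σ a₀ u₀ θ₀ N (Φ N)) Φ
    (fun x => totalEnergyDensity (ρ t x) (u t x) (θ t x)) hEc t hlow ?_
  exact tendsto_totalUpper_of_tendsto_abs (fun N => localGibbsLaw σ a₀ u₀ θ₀ N (Φ N)) Φ _ t
    fun δ hδ => KineticClosureConservation.tendsto_energyField_const hE hp Φ h0 ht 1 hδ

end Summit.AtomisticToContinuum.HydrodynamicLimit.Theorems

end
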